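import Mathlib
import HarnessLib
import Summits.QuantumFields.YangMills.Theorems.FemtoCurvatureTwoPoint.Negative.UpperOnly
import Summits.QuantumFields.YangMills.Theorems.LangevinControlUVFemtoCurvatureTwoPointEncoding
import Summits.QuantumFields.YangMills.Theorems.LangevinControlUVFemtoCurvatureTwoPointRateFreeAux

/-!
# Crux `FemtoCurvatureTwoPoint` (stmt-QuantumFields-9363, route `LangevinControlUV`):
# the rate-free encoding, II — the encoding for an abstract covariance functional

Support file of the line `generic-step-gamma-encoding` (lead c3, `--supports stmt-QuantumFields-9363`;
registered name `shapeFree_encoding`). Part II of three (`…RateFreeAux` ⊂ this ⊂ `…RateFree`): the refined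
generic-step encoding carried out for an ABSTRACT functional `Φ L β x i j y i' j'` (continuity in `β`,
freezing, eventual shape-free bounds ⇒ both clauses of the crux with `ℓ₀ = 1`, `c = 1/(2K)`, `C = 2K`).
The crux-level statement (Wilson plaquette covariances) is in `…RateFree`; construction in the docstring below.
-/

set_option autoImplicit false

noncomputable section

open Filter Topology MeasureTheory
open Summit.QuantumFields.YangMills.Theorems.FemtoCurvatureTwoPoint.Negative.UpperOnly
  (torusDist_le_side)
open Summit.QuantumFields.YangMills.Cruxes.FemtoCurvatureTwoPoint.GenericStepGammaEncoding
  (exists_generic)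

namespace Summit.QuantumFields.YangMills.Theorems.FemtoCurvatureTwoPoint.RateFree

/-! ## §6 The rate-free encoding for an ABSTRACT covariance functional -/

/-- **Rate-free encoding, abstract form.** Let `Φ L β x i j y i' j'` be a real functional of a torus side,
a coupling and two plaquettes, continuous in `β`, tending to `0` as `β → ∞` on every torus `L ≠ 0`;
`ax L β n = Φ L β 0 0 1 (n e₂) 0 1`. If ONE constant `K` gives, for every ceiling `L₀`,
a threshold beyond which for all `L, L' ≤ L₀` (`L' ≥ 1`) and `1 ≤ n ≤ L/8`: `0 < ax L β n`,
`ax L' β n ≤ K ax L β n` when `8n ≤ L'`, and `|Φ L' β x i j y i' j'| ≤ K ax L β n` for all `x ≠ y` in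
`(ℤ/L')⁴` at torus distance `n` and `i ≠ j`, `i' ≠ j'` — then there are a unit map `a > 0` with `a → 0`,
a shape `Γ ∈ (0, 1]`, a threshold `β₀` and `0 < c ≤ C` such that on every torus `L ≥ 1` with `β ≥ β₀` and
`L a(β) ≤ 1`: `c Γ(n a β) ≤ n⁸ ax L β n ≤ C Γ(n a β)` (`1 ≤ n ≤ L/8`) and
`|Φ L β x i j y i' j'| dist(x,y)⁸ ≤ C Γ(dist(x,y) a β)` (`x ≠ y`, `i ≠ j`, `i' ≠ j'`). Construction:
coupling blocks `[T'(M), T'(M+1))` from the thresholds (hypothesis at ceiling `M`, freezing `|Φ| L⁸ ≤ 1` on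
`L ≤ M`), each cut into pieces on which every `ax L · n` (`L ≤ M`) varies by at most a factor `2`
(`exists_delta_le_two_mul_family`, `piece_spec`); generic step values `α_p = (1 + t 2^{-p})/(M+1)` on the
piece coded `p = Nat.pair M j` (femto tori at `β` = `L ≤ M`); `Γ(n α_p) := n⁸ ax (8n) β_p n` at the piece's
left end, `Γ := 1` on non-encoded arguments (where freezing suffices). [folklore] -/
theorem shapeFree_encoding
    (Φ : (L : ℕ) → ℝ → (Fin 4 → ZMod L) → Fin 4 → Fin 4 → (Fin 4 → ZMod L) → Fin 4 → Fin 4 → ℝ)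
    (hcont : ∀ (L : ℕ), L ≠ 0 → ∀ (x : Fin 4 → ZMod L) (i j : Fin 4) (y : Fin 4 → ZMod L)
      (i' j' : Fin 4), Continuous fun β => Φ L β x i j y i' j')
    (hfreeze : ∀ (L : ℕ), L ≠ 0 → ∀ (x : Fin 4 → ZMod L) (i j : Fin 4) (y : Fin 4 → ZMod L)
      (i' j' : Fin 4), Tendsto (fun β => Φ L β x i j y i' j') atTop (𝓝 0))
    (H : ∃ K : ℝ, 0 < K ∧ ∀ L₀ : ℕ, ∃ T : ℝ, ∀ β : ℝ, T ≤ β →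
      ∀ (L L' n : ℕ), 1 ≤ L' → 1 ≤ n → 8 * n ≤ L → L ≤ L₀ → L' ≤ L₀ →
        0 < Φ L β 0 0 1 (Pi.single (2 : Fin 4) ((n : ℕ) : ZMod L)) 0 1 ∧
        (8 * n ≤ L' → Φ L' β 0 0 1 (Pi.single (2 : Fin 4) ((n : ℕ) : ZMod L')) 0 1 ≤
            K * Φ L β 0 0 1 (Pi.single (2 : Fin 4) ((n : ℕ) : ZMod L)) 0 1) ∧
        ∀ (x y : Fin 4 → ZMod L') (i j i' j' : Fin 4), x ≠ y → i ≠ j → i' ≠ j' →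
          Real.sqrt (∑ k : Fin 4, (((x k - y k).valMinAbs : ℤ) : ℝ) ^ 2) = n →
            |Φ L' β x i j y i' j'| ≤ K * Φ L β 0 0 1 (Pi.single (2 : Fin 4) ((n : ℕ) : ZMod L)) 0 1) :
    ∃ (a Γ : ℝ → ℝ) (β₀ c C : ℝ), 0 < c ∧ (∀ β, 0 < a β) ∧ Tendsto a atTop (𝓝 0) ∧
      (∀ s : ℝ, 0 < Γ s ∧ Γ s ≤ 1) ∧
      ∀ (L : ℕ), L ≠ 0 → ∀ (β : ℝ), β₀ ≤ β → (L : ℝ) * a β ≤ 1 →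
        (∀ n : ℕ, 1 ≤ n → 8 * n ≤ L →
            c * Γ ((n : ℝ) * a β) ≤
                (n : ℝ) ^ 8 * Φ L β 0 0 1 (Pi.single (2 : Fin 4) ((n : ℕ) : ZMod L)) 0 1 ∧
            (n : ℝ) ^ 8 * Φ L β 0 0 1 (Pi.single (2 : Fin 4) ((n : ℕ) : ZMod L)) 0 1 ≤
                C * Γ ((n : ℝ) * a β)) ∧
        (∀ (x y : Fin 4 → ZMod L) (i j i' j' : Fin 4), x ≠ y → i ≠ j → i' ≠ j' →
            |Φ L β x i j y i' j'| * Real.sqrt (∑ k : Fin 4, (((x k - y k).valMinAbs : ℤ) : ℝ) ^ 2) ^ 8 ≤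
              C * Γ (Real.sqrt (∑ k : Fin 4, (((x k - y k).valMinAbs : ℤ) : ℝ) ^ 2) * a β)) := by
  classical
  let ax : (L : ℕ) → ℝ → ℕ → ℝ := fun L β n => Φ L β 0 0 1 (Pi.single (2 : Fin 4) ((n : ℕ) : ZMod L)) 0 1
  obtain ⟨K₀, hK₀, hT⟩ := H
  obtain ⟨K, hK1, hK0, hKK⟩ : ∃ K : ℝ, 1 ≤ K ∧ 0 < K ∧ K₀ ≤ K :=
    ⟨max K₀ 1, le_max_right _ _, one_pos.trans_le (le_max_right _ _), le_max_left _ _⟩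
  have hSF : ∀ L₀ : ℕ, ∃ T : ℝ, ∀ β : ℝ, T ≤ β →
      ∀ (L L' n : ℕ), 1 ≤ L' → 1 ≤ n → 8 * n ≤ L → L ≤ L₀ → L' ≤ L₀ →
        0 < ax L β n ∧ (8 * n ≤ L' → ax L' β n ≤ K * ax L β n) ∧
        ∀ (x y : Fin 4 → ZMod L') (i j i' j' : Fin 4), x ≠ y → i ≠ j → i' ≠ j' →
          Real.sqrt (∑ k : Fin 4, (((x k - y k).valMinAbs : ℤ) : ℝ) ^ 2) = n →
            |Φ L' β x i j y i' j'| ≤ K * ax L β n := by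
    intro L₀
    obtain ⟨T, hT'⟩ := hT L₀
    refine ⟨T, fun β hβ L L' n hL' hn h8 hL hL'' => ?_⟩
    obtain ⟨h1, h2, h3⟩ := hT' β hβ L L' n hL' hn h8 hL hL''
    exact ⟨h1, fun h8' => (h2 h8').trans (mul_le_mul_of_nonneg_right hKK h1.le),
      fun x y i j i' j' hxy hij hij' hd =>
        (h3 x y i j i' j' hxy hij hij' hd).trans (mul_le_mul_of_nonneg_right hKK h1.le)⟩
  choose T₁ hT₁ using hSF
  -- ### freezing thresholds: on torus `L ≠ 0`, every `|Φ L β …| · L⁸` is eventually `≤ 1`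
  let good : ℕ → ℝ → Prop := fun L β => L ≠ 0 →
    ∀ t : ((Fin 4 → ZMod L) × (Fin 4 → ZMod L)) × ((Fin 4 × Fin 4) × (Fin 4 × Fin 4)),
      |Φ L β t.1.1 t.2.1.1 t.2.1.2 t.1.2 t.2.2.1 t.2.2.2| * (L : ℝ) ^ 8 ≤ 1
  have hE : ∀ L, ∀ᶠ β in atTop, good L β := fun L => by
    by_cases hL : L = 0
    · exact Filter.Eventually.of_forall fun β h => absurd hL h
    · haveI : NeZero L := ⟨hL⟩
      have : ∀ᶠ β in atTop,
          ∀ t : ((Fin 4 → ZMod L) × (Fin 4 → ZMod L)) × ((Fin 4 × Fin 4) × (Fin 4 × Fin 4)),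
            |Φ L β t.1.1 t.2.1.1 t.2.1.2 t.1.2 t.2.2.1 t.2.2.2| * (L : ℝ) ^ 8 ≤ 1 := by
        refine Filter.eventually_all.2 fun t => ?_
        have ht := hfreeze L hL t.1.1 t.2.1.1 t.2.1.2 t.1.2 t.2.2.1 t.2.2.2
        have h8 : (0 : ℝ) < (L : ℝ) ^ 8 := by positivity
        filter_upwards [(Metric.tendsto_nhds.1 ht) _ (one_div_pos.2 h8)] with β hβ
        rw [Real.dist_eq, sub_zero, lt_div_iff₀ h8] at hβ
        exact hβ.le
      exact this.mono fun β hβ _ => hβ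
  have hG : ∀ M, ∀ᶠ β in atTop, ∀ L ∈ Finset.range (M + 1), good L β := fun M =>
    (Filter.eventually_all_finset _).2 fun L _ => hE L
  choose T₂ hT₂ using fun M => Filter.eventually_atTop.1 (hG M)
  -- ### the monotone envelope of the thresholds; coupling blocks `[T' M, T' (M+1))`
  let T' : ℕ → ℝ := fun M => (∑ k ∈ Finset.range (M + 1), (|T₁ k| + |T₂ k|)) + M
  have hT'12 : ∀ M, T₁ M ≤ T' M ∧ T₂ M ≤ T' M := fun M => by
    have h1 : |T₁ M| + |T₂ M| ≤ ∑ k ∈ Finset.range (M + 1), (|T₁ k| + |T₂ k|) :=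
      Finset.single_le_sum (f := fun k => |T₁ k| + |T₂ k|) (fun k _ => by positivity)
        (Finset.self_mem_range_succ M)
    have h2 := le_abs_self (T₁ M)
    have h3 := le_abs_self (T₂ M)
    have h2' := abs_nonneg (T₁ M)
    have h3' := abs_nonneg (T₂ M)
    have h4 : (0 : ℝ) ≤ M := Nat.cast_nonneg M
    simp only [T']
    constructor <;> linarith
  have hT'm : ∀ M : ℕ, (M : ℝ) ≤ T' M := fun M => by
    have := Finset.sum_nonneg fun k (_ : k ∈ Finset.range (M + 1)) =>
      (show (0 : ℝ) ≤ |T₁ k| + |T₂ k| by positivity)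
    simp only [T']
    linarith
  have hT'succ : ∀ M : ℕ, T' M + 1 ≤ T' (M + 1) := fun M => by
    simp only [T']
    rw [Finset.sum_range_succ _ (M + 1)]
    have : (0 : ℝ) ≤ |T₁ (M + 1)| + |T₂ (M + 1)| := by positivity
    push_cast
    linarith
  have hT'mono : Monotone T' := monotone_nat_of_le_succ fun M => by linarith [hT'succ M]
  let Mof : ℝ → ℕ := fun β => Nat.findGreatest (fun m => T' m ≤ β) ⌊β⌋₊
  have hMspec : ∀ β, T' 0 ≤ β → T' (Mof β) ≤ β := fun β h0 =>
    Nat.findGreatest_spec (P := fun m => T' m ≤ β) (Nat.zero_le _) h0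
  have hMge : ∀ β m, T' m ≤ β → m ≤ Mof β := fun β m hm =>
    Nat.le_findGreatest (Nat.le_floor ((hT'm m).trans hm)) hm
  have hMlt : ∀ β, β < T' (Mof β + 1) := fun β => by
    by_contra h
    have := hMge β (Mof β + 1) (not_lt.1 h)
    omega
  -- ### per-block modulus `δ M`: the finitely many axis functionals vary by at most a factor 2
  let F : (M : ℕ) → Fin (M + 1) × Fin (M + 1) → ℝ → ℝ := fun M i β =>
    if 1 ≤ (i.2 : ℕ) ∧ 8 * (i.2 : ℕ) ≤ (i.1 : ℕ) then ax i.1 β i.2 else 1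
  have hδ : ∀ M, ∃ δ : ℝ, 0 < δ ∧ ∀ i, ∀ β ∈ Set.Icc (T' M) (T' (M + 1)),
      ∀ β' ∈ Set.Icc (T' M) (T' (M + 1)), |β - β'| ≤ δ → F M i β ≤ 2 * F M i β' := by
    intro M
    refine exists_delta_le_two_mul_family (F M) (fun i => ?_) (fun i β hβ => ?_)
    · by_cases h : 1 ≤ (i.2 : ℕ) ∧ 8 * (i.2 : ℕ) ≤ (i.1 : ℕ)
      · have hc := hcont i.1 (by omega) 0 0 1 (Pi.single (2 : Fin 4) (((i.2 : ℕ) : ℕ) : ZMod i.1)) 0 1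
        refine (hc.continuousOn (s := Set.Icc (T' M) (T' (M + 1)))).congr fun β _ => ?_
        simp only [F, if_pos h, ax]
      · refine (continuousOn_const (c := (1 : ℝ))).congr fun β _ => ?_
        simp only [F, if_neg h]
    · by_cases h : 1 ≤ (i.2 : ℕ) ∧ 8 * (i.2 : ℕ) ≤ (i.1 : ℕ)
      · have hβT : T₁ M ≤ β := (hT'12 M).1.trans hβ.1
        have hiM : (i.1 : ℕ) ≤ M := Nat.lt_succ_iff.1 i.1.isLt
        have := (hT₁ M β hβT i.1 i.1 i.2 (by omega) h.1 h.2 hiM hiM).1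
        simp only [F, if_pos h]
        exact this
      · simp only [F, if_neg h]
        exact one_pos
  choose δ hδpos hδspec using hδ
  let Nof : ℕ → ℕ := fun M => ⌈(T' (M + 1) - T' M) / δ M⌉₊ + 1
  let hof : ℕ → ℝ := fun M => (T' (M + 1) - T' M) / (Nof M)
  let jof : ℝ → ℕ := fun β => ⌊(β - T' (Mof β)) / hof (Mof β)⌋₊
  let βref : ℕ → ℕ → ℝ := fun M j => T' M + j * hof M
  let code : ℝ → ℕ := fun β => Nat.pair (Mof β) (jof β)
  have hpiece : ∀ β, T' 0 ≤ β →
      jof β < Nof (Mof β) ∧ βref (Mof β) (jof β) ∈ Set.Icc (T' (Mof β)) (T' (Mof β + 1)) ∧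
        β ∈ Set.Icc (T' (Mof β)) (T' (Mof β + 1)) ∧ |β - βref (Mof β) (jof β)| ≤ δ (Mof β) := by
    intro β h0
    have hA : T' (Mof β) ≤ β := hMspec β h0
    have hB : β < T' (Mof β + 1) := hMlt β
    have hAB : T' (Mof β) < T' (Mof β + 1) := by linarith [hT'succ (Mof β)]
    obtain ⟨-, -, hjN, hA1, hA2, -, hA3, hd⟩ := piece_spec hAB (hδpos (Mof β)) hA hB
    exact ⟨hjN, ⟨hA1, hA3.le⟩, ⟨hA, hB.le⟩, hd⟩
  have hβref : ∀ M j, j < Nof M → βref M j ∈ Set.Icc (T' M) (T' (M + 1)) := by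
    intro M j hj
    have hAB : T' M < T' (M + 1) := by linarith [hT'succ M]
    have hN : (0 : ℝ) < Nof M := by positivity
    have hh : 0 < hof M := div_pos (sub_pos.2 hAB) hN
    have hN0 : (Nof M : ℝ) ≠ 0 := hN.ne'
    have hNh : (Nof M : ℝ) * hof M = T' (M + 1) - T' M := by
      simp only [hof]; field_simp
    have hj' : (j : ℝ) ≤ (Nof M : ℝ) - 1 := by
      have : j + 1 ≤ Nof M := hj
      have : ((j + 1 : ℕ) : ℝ) ≤ Nof M := by exact_mod_cast this
      push_cast at this; linarith
    constructor
    · simp only [βref]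
      nlinarith [mul_nonneg (Nat.cast_nonneg j) hh.le]
    · simp only [βref]
      nlinarith [mul_le_mul_of_nonneg_right hj' hh.le]
  obtain ⟨t, ht1, ht2, hgen⟩ :=
    exists_generic (fun p => (((Nat.unpair p).1 : ℝ) + 1)⁻¹) (fun p => by positivity)
  have ht0 : 0 < t := by linarith
  let α : ℕ → ℝ := fun p => (((Nat.unpair p).1 : ℝ) + 1)⁻¹ * (1 + t * ((2 : ℝ) ^ p)⁻¹)
  have hαpos : ∀ p, 0 < α p := fun p => stepVal_pos ht0.le p
  have hgen' : ∀ (p p' m m' : ℕ), p ≠ p' → 1 ≤ m → 1 ≤ m' →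
      Real.sqrt m * α p ≠ Real.sqrt m' * α p' := hgen
  have hsq : ∀ n : ℕ, (n : ℝ) = Real.sqrt ((n ^ 2 : ℕ) : ℝ) := fun n => by
    push_cast
    rw [Real.sqrt_sq (Nat.cast_nonneg n)]
  let valid : ℕ → Prop := fun p => (Nat.unpair p).2 < Nof (Nat.unpair p).1
  let enc : ℝ → Prop := fun s => ∃ q : ℕ × ℕ, valid q.1 ∧ 1 ≤ q.2 ∧
    8 * q.2 ≤ (Nat.unpair q.1).1 ∧ s = (q.2 : ℝ) * α q.1
  let refVal : ℕ × ℕ → ℝ := fun q =>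
    (q.2 : ℝ) ^ 8 * ax (8 * q.2) (βref (Nat.unpair q.1).1 (Nat.unpair q.1).2) q.2
  let Γ : ℝ → ℝ := fun s => if h : enc s then refVal (Classical.choose h) else 1
  have henc_unique : ∀ (q q' : ℕ × ℕ), 1 ≤ q.2 → 1 ≤ q'.2 →
      (q.2 : ℝ) * α q.1 = (q'.2 : ℝ) * α q'.1 → q = q' := by
    intro q q' hq hq' heq
    have hp : q.1 = q'.1 := by
      by_contra hne
      apply hgen' q.1 q'.1 (q.2 ^ 2) (q'.2 ^ 2) hne (by nlinarith) (by nlinarith)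
      rw [← hsq, ← hsq]
      exact heq
    have hn : (q.2 : ℝ) = q'.2 := by
      rw [hp] at heq
      exact mul_right_cancel₀ (hαpos q'.1).ne' heq
    have hn' : q.2 = q'.2 := by exact_mod_cast hn
    exact Prod.ext hp hn'
  have hΓ_enc : ∀ q : ℕ × ℕ, valid q.1 → 1 ≤ q.2 → 8 * q.2 ≤ (Nat.unpair q.1).1 →
      Γ ((q.2 : ℝ) * α q.1) = refVal q := by
    intro q hv hq h8
    have h : enc ((q.2 : ℝ) * α q.1) := ⟨q, hv, hq, h8, rfl⟩
    simp only [Γ, dif_pos h]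
    obtain ⟨-, hq', -, heq⟩ := Classical.choose_spec h
    rw [henc_unique (Classical.choose h) q hq' hq heq.symm]
  have hrefVal : ∀ q : ℕ × ℕ, valid q.1 → 1 ≤ q.2 → 8 * q.2 ≤ (Nat.unpair q.1).1 →
      0 < refVal q ∧ refVal q ≤ 1 := by
    intro q hv hq h8
    have hβr := hβref (Nat.unpair q.1).1 (Nat.unpair q.1).2 hv
    have hn8 : (0 : ℝ) < (q.2 : ℝ) ^ 8 := by positivity
    have hpos : 0 < ax (8 * q.2) (βref (Nat.unpair q.1).1 (Nat.unpair q.1).2) q.2 :=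
      (hT₁ (Nat.unpair q.1).1 (βref (Nat.unpair q.1).1 (Nat.unpair q.1).2)
        ((hT'12 _).1.trans hβr.1) (8 * q.2) (8 * q.2) q.2 (by omega) hq le_rfl h8 h8).1
    have hle : ax (8 * q.2) (βref (Nat.unpair q.1).1 (Nat.unpair q.1).2) q.2 *
        ((8 * q.2 : ℕ) : ℝ) ^ 8 ≤ 1 := by
      have hg := hT₂ (Nat.unpair q.1).1 (βref (Nat.unpair q.1).1 (Nat.unpair q.1).2)
        ((hT'12 _).2.trans hβr.1) (8 * q.2) (Finset.mem_range.2 (by omega)) (by omega)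
        (((0 : Fin 4 → ZMod (8 * q.2)), Pi.single (2 : Fin 4) ((q.2 : ℕ) : ZMod (8 * q.2))),
          (((0 : Fin 4), (1 : Fin 4)), ((0 : Fin 4), (1 : Fin 4))))
      exact le_trans (mul_le_mul_of_nonneg_right (le_abs_self _) (by positivity)) hg
    have h88 : (q.2 : ℝ) ^ 8 ≤ ((8 * q.2 : ℕ) : ℝ) ^ 8 :=
      pow_le_pow_left₀ (Nat.cast_nonneg _) (by exact_mod_cast (by omega : q.2 ≤ 8 * q.2)) 8
    refine ⟨mul_pos hn8 hpos, ?_⟩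
    calc (q.2 : ℝ) ^ 8 * ax (8 * q.2) (βref (Nat.unpair q.1).1 (Nat.unpair q.1).2) q.2
          ≤ ((8 * q.2 : ℕ) : ℝ) ^ 8 * ax (8 * q.2) (βref (Nat.unpair q.1).1 (Nat.unpair q.1).2) q.2 :=
          mul_le_mul_of_nonneg_right h88 hpos.le
      _ ≤ 1 := by rw [mul_comm]; exact hle
  have hΓ : ∀ s : ℝ, 0 < Γ s ∧ Γ s ≤ 1 := fun s => by
    by_cases h : enc s
    · obtain ⟨hv, hq, h8, -⟩ := Classical.choose_spec h
      simp only [Γ, dif_pos h]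
      exact hrefVal _ hv hq h8
    · simp only [Γ, dif_neg h]
      exact ⟨one_pos, le_rfl⟩
  let a : ℝ → ℝ := fun β => if T' 0 ≤ β then α (code β) else 1
  have ha_pos : ∀ β, 0 < a β := fun β => by
    simp only [a]
    split_ifs
    · exact hαpos _
    · exact one_pos
  have ha_of : ∀ β, T' 0 ≤ β → a β = α (code β) := fun β h => by simp only [a, if_pos h]
  refine ⟨a, Γ, T' 0, 1 / (2 * K), 2 * K, div_pos one_pos (mul_pos two_pos hK0), ha_pos, ?_, hΓ, ?_⟩
  · -- `a → 0`
    refine Metric.tendsto_atTop.2 fun ε hε => ?_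
    obtain ⟨m, hm⟩ := exists_nat_one_div_lt (half_pos hε)
    refine ⟨T' m, fun β hβ => ?_⟩
    have h0 : T' 0 ≤ β := (hT'mono (Nat.zero_le m)).trans hβ
    rw [Real.dist_eq, sub_zero, abs_of_pos (ha_pos β), ha_of β h0]
    have hmM : (m : ℝ) + 1 ≤ ((Nat.unpair (code β)).1 : ℝ) + 1 := by
      have : (Nat.unpair (code β)).1 = Mof β := by simp only [code, Nat.unpair_pair]
      rw [this]
      exact_mod_cast Nat.succ_le_succ (hMge β m hβ)
    calc α (code β) ≤ 2 / (((Nat.unpair (code β)).1 : ℝ) + 1) := stepVal_le ht2 _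
      _ ≤ 2 / ((m : ℝ) + 1) := div_le_div_of_nonneg_left (by norm_num) (by positivity) hmM
      _ = 2 * (1 / ((m : ℝ) + 1)) := by ring
      _ < 2 * (ε / 2) := by gcongr
      _ = ε := by ring
  · -- ### the clauses on a femto torus
    intro L hL0 β hβ0 hLa
    -- the block `M = Mof β`, the piece `j = jof β`, the code `p = code β`, the reference coupling
    -- `β' = βref M j`
    obtain ⟨hjN, hβr, hβI, hβd⟩ := hpiece β hβ0
    have hpM : (Nat.unpair (code β)).1 = Mof β := by simp only [code, Nat.unpair_pair]
    have hpj : (Nat.unpair (code β)).2 = jof β := by simp only [code, Nat.unpair_pair]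
    have hvalid : valid (code β) := by
      show (Nat.unpair (code β)).2 < Nof (Nat.unpair (code β)).1
      rw [hpM, hpj]; exact hjN
    have haβ : a β = α (code β) := ha_of β hβ0
    have hLM : L ≤ Mof β := by
      rw [haβ] at hLa
      have := le_of_femto ht0 (p := code β) (L := L) hLa
      rwa [hpM] at this
    have hL1 : 1 ≤ L := Nat.one_le_iff_ne_zero.2 hL0
    have hβT₁ : T₁ (Mof β) ≤ β := (hT'12 (Mof β)).1.trans hβI.1
    have hβT₂ : T₂ (Mof β) ≤ β := (hT'12 (Mof β)).2.trans hβI.1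
    -- factor-2 comparison between `β` and `β'` for the reference axis functional at `(8n, n)`
    have hcmp : ∀ n : ℕ, 1 ≤ n → 8 * n ≤ Mof β →
        ax (8 * n) β n ≤ 2 * ax (8 * n) (βref (Mof β) (jof β)) n ∧
          ax (8 * n) (βref (Mof β) (jof β)) n ≤ 2 * ax (8 * n) β n := by
      intro n hn h8
      let i : Fin (Mof β + 1) × Fin (Mof β + 1) := (⟨8 * n, by omega⟩, ⟨n, by omega⟩)
      have hi : (1 ≤ (i.2 : ℕ) ∧ 8 * (i.2 : ℕ) ≤ (i.1 : ℕ)) := ⟨by simpa [i] using hn, by simp [i]⟩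
      have hβd' : |βref (Mof β) (jof β) - β| ≤ δ (Mof β) := by rwa [abs_sub_comm]
      refine ⟨?_, ?_⟩
      · have h := hδspec (Mof β) i β hβI (βref (Mof β) (jof β)) hβr hβd
        simp only [F, if_pos hi] at h
        exact h
      · have h := hδspec (Mof β) i (βref (Mof β) (jof β)) hβr β hβI hβd'
        simp only [F, if_pos hi] at h
        exact h
    refine ⟨fun n hn h8 => ?_, fun x y i j i' j' hxy hij hij' => ?_⟩
    · -- #### the axis clause at `(L, β, n)`
      have h8M : 8 * n ≤ Mof β := h8.trans hLM
      have hΓn : Γ ((n : ℝ) * a β) = (n : ℝ) ^ 8 * ax (8 * n) (βref (Mof β) (jof β)) n := by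
        rw [haβ]
        have := hΓ_enc (code β, n) hvalid hn (by rw [hpM]; exact h8M)
        simp only [refVal, hpM, hpj] at this
        exact this
      obtain ⟨hc1, hc2⟩ := hcmp n hn h8M
      have hA := hT₁ (Mof β) β hβT₁ L (8 * n) n (by omega) hn h8 hLM h8M
      have hB := hT₁ (Mof β) β hβT₁ (8 * n) L n hL1 hn le_rfl h8M hLM
      have h1 : ax (8 * n) β n ≤ K * ax L β n := hA.2.1 le_rfl
      have h2 : ax L β n ≤ K * ax (8 * n) β n := hB.2.1 h8
      have hn8 : (0 : ℝ) < (n : ℝ) ^ 8 := by positivity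
      change 1 / (2 * K) * Γ ((n : ℝ) * a β) ≤ (n : ℝ) ^ 8 * ax L β n ∧
        (n : ℝ) ^ 8 * ax L β n ≤ 2 * K * Γ ((n : ℝ) * a β)
      rw [hΓn]
      constructor
      · -- `ax(8n, β') ≤ 2 ax(8n, β) ≤ 2K ax(L, β)`
        have h3 : ax (8 * n) (βref (Mof β) (jof β)) n ≤ 2 * K * ax L β n := by linarith
        have h4 : 1 / (2 * K) * ((n : ℝ) ^ 8 * ax (8 * n) (βref (Mof β) (jof β)) n) =
            (n : ℝ) ^ 8 * (ax (8 * n) (βref (Mof β) (jof β)) n / (2 * K)) := by ring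
        rw [h4]
        refine mul_le_mul_of_nonneg_left ?_ hn8.le
        rw [div_le_iff₀ (mul_pos two_pos hK0)]
        linarith
      · -- `ax(L, β) ≤ K ax(8n, β) ≤ 2K ax(8n, β')`
        have h3 : ax L β n ≤ 2 * K * ax (8 * n) (βref (Mof β) (jof β)) n := by
          nlinarith [mul_le_mul_of_nonneg_left hc1 hK0.le]
        nlinarith [mul_le_mul_of_nonneg_left h3 hn8.le]
    · -- #### the all-pairs clause at `(L, β, x, y)`
      haveI : NeZero L := ⟨hL0⟩
      obtain ⟨m, hm, hdm⟩ := dist_eq_sqrt_nat x y hxy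
      have hdL : Real.sqrt (∑ k : Fin 4, (((x k - y k).valMinAbs : ℤ) : ℝ) ^ 2) ≤ L :=
        torusDist_le_side x y
      have hd0 : 0 ≤ Real.sqrt (∑ k : Fin 4, (((x k - y k).valMinAbs : ℤ) : ℝ) ^ 2) :=
        Real.sqrt_nonneg _
      -- freezing: `|Φ| · L⁸ ≤ 1`
      have hfz : |Φ L β x i j y i' j'| * (L : ℝ) ^ 8 ≤ 1 :=
        hT₂ (Mof β) β hβT₂ L (Finset.mem_range.2 (by omega)) hL0 ((x, y), ((i, j), (i', j')))
      have hfz' : |Φ L β x i j y i' j'| *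
          Real.sqrt (∑ k : Fin 4, (((x k - y k).valMinAbs : ℤ) : ℝ) ^ 2) ^ 8 ≤ 1 :=
        le_trans (mul_le_mul_of_nonneg_left (pow_le_pow_left₀ hd0 hdL 8) (abs_nonneg _)) hfz
      by_cases he : enc (Real.sqrt (∑ k : Fin 4, (((x k - y k).valMinAbs : ℤ) : ℝ) ^ 2) * a β)
      · -- an encoded level: same piece by genericity, distance `n' = q.2`, and (iii) applies
        obtain ⟨q, hv, hq, hq8, heq⟩ := he
        have hqp : q.1 = code β := by
          by_contra hne
          apply hgen' q.1 (code β) (q.2 ^ 2) m hne (by nlinarith) hm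
          rw [← hsq, ← heq, hdm, haβ]
        have hdist : Real.sqrt (∑ k : Fin 4, (((x k - y k).valMinAbs : ℤ) : ℝ) ^ 2) = q.2 := by
          rw [haβ, hqp] at heq
          exact mul_right_cancel₀ (hαpos (code β)).ne' heq
        have hq8M : 8 * q.2 ≤ Mof β := by rw [hqp, hpM] at hq8; exact hq8
        have hΓq : Γ (Real.sqrt (∑ k : Fin 4, (((x k - y k).valMinAbs : ℤ) : ℝ) ^ 2) * a β) =
            (q.2 : ℝ) ^ 8 * ax (8 * q.2) (βref (Mof β) (jof β)) q.2 := by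
          rw [hdist, haβ, ← hqp]
          have := hΓ_enc q hv hq hq8
          simp only [refVal] at this
          rw [this, hqp, hpM, hpj]
        rw [hΓq, hdist]
        -- (iii): `|Φ L β x y| ≤ K ax(8 q.2, β) ≤ 2K ax(8 q.2, β')`
        have hC := (hT₁ (Mof β) β hβT₁ (8 * q.2) L q.2 hL1 hq le_rfl hq8M hLM).2.2 x y i j i' j'
          hxy hij hij' hdist
        obtain ⟨hc1, -⟩ := hcmp q.2 hq hq8M
        have hn8 : (0 : ℝ) ≤ (q.2 : ℝ) ^ 8 := by positivity
        have h3 : |Φ L β x i j y i' j'| ≤ 2 * K * ax (8 * q.2) (βref (Mof β) (jof β)) q.2 := by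
          nlinarith [mul_le_mul_of_nonneg_left hc1 hK0.le]
        calc |Φ L β x i j y i' j'| * (q.2 : ℝ) ^ 8
              ≤ (2 * K * ax (8 * q.2) (βref (Mof β) (jof β)) q.2) * (q.2 : ℝ) ^ 8 :=
              mul_le_mul_of_nonneg_right h3 hn8
          _ = 2 * K * ((q.2 : ℝ) ^ 8 * ax (8 * q.2) (βref (Mof β) (jof β)) q.2) := by ring
      · -- a free argument: `Γ = 1`, and freezing
        have hΓ1 : Γ (Real.sqrt (∑ k : Fin 4, (((x k - y k).valMinAbs : ℤ) : ℝ) ^ 2) * a β) = 1 := by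
          simp only [Γ, dif_neg he]
        rw [hΓ1, mul_one]
        linarith

end Summit.QuantumFields.YangMills.Theorems.FemtoCurvatureTwoPoint.RateFree

end
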